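import Summits.Ventures.PercRepro.RankLevelSetLevelSixHeavyCellSq27DI2VTriTri
import Summits.Ventures.PercRepro.RankLevelSetLevelSixT22Free7
import Summits.Ventures.PercRepro.RankLevelSetLevelSixArithTwoSq22F8
import Summits.Ventures.PercRepro.RankLevelSetLevelSixArithTriTriSq22F8
import Summits.Ventures.PercRepro.RankLevelSetCoreSixColoopFreeUnion

/-!
# PercRepro — THE COLOOP-FREE CELL `(22, 8)` MODULO THE BRANCH `s₃ ≥ 7` (p8 g12, S3)

`proofs/P8-G12-LEVER22.md` §7. On a coloop-free `e`-free core of rank `22`, corank `8`: at most two triangles — the existing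
cell `sq27di2v` at `c₃ = 2` (ratio `0.914`, `c025_core_six_t22_free8_two`); three distinct triangles and at most six — THE
THREE-TRIANGLE CELL (form (i) of THE CONFINEMENT LEMMA: the `6`-set term `C(30, 6) − C(21, 6)`; ratio `0.976`,
`c025_core_six_t22_free8_tritri`); seven or more triangles — OPEN (form (ii): the confinement count with `S₃` = the union of
the triangles, `ν(S₃) ≥ 5`), taken as the hypothesis `h7` of `c025_core_six_t22_free8_of_seven`. Axioms: standard.
-/

open scoped Matroid

namespace PercRepro

namespace ThmN

open Set

variable {α : Type}

set_option maxHeartbeats 1600000 in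
/-- **THE COLOOP-FREE CELL `(22, 8)` WITH AT MOST TWO TRIANGLES** (the existing cell `sq27di2v`, `c₃ = 2`). -/
theorem c025_core_six_t22_free8_two (M : Matroid α) [M.Finite] (hcf : ∀ e ∈ M.E, ¬ M.IsColoop e)
    (hR : M.eRank = (22 : ℕ∞)) (hn : M.E.ncard = 22 + 8)
    (hfree : ∀ e ∈ M.E, ∃ A ⊆ M.E \ {e}, e ∉ M.closure A ∧ e ∉ M.closure ((M.E \ {e}) \ A))
    (hs3 : {C : Set α | M.IsCircuit C ∧ C.ncard = 3}.ncard ≤ 2) :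
    RLS M 22 6 := by
  classical
  have hR' : M.eRank = ((22 : ℕ) : ℕ∞) := hR
  have hd : M.E.encard = M.eRank + (8 : ℕ) := by
    rw [hR, ← M.ground_finite.cast_ncard_eq, hn]
    push_cast
    ring
  have hc : ∀ X ⊆ M.E, M.eRk X ≤ ((6 - 2 : ℕ) : ℕ∞) → (X.ncard : ℕ∞) ≤ M.eRk X + cnull 4 :=
    fun X hX hr => nullity_cap_core M hfree 4 (le_refl 4) X hX (by simpa using hr)
  have hc6 : cnull 4 + 1 ≤ 7 := by simp [cnull]
  have hcj : ∀ X ⊆ M.E, M.eRk X ≤ ((6 - 2 - 1 : ℕ) : ℕ∞) → (X.ncard : ℕ∞) ≤ M.eRk X + cnull (3) :=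
    fun X hX hr => nullity_cap_core M hfree 3 (by omega) X hX
      (by rwa [show (6 - 2 - 1 : ℕ) = 3 by omega] at hr)
  have hcj' : ∀ X ⊆ M.E, M.eRk X ≤ ((6 - 1 - 1 - 1 : ℕ) : ℕ∞) → (X.ncard : ℕ∞) ≤ M.eRk X + cnull (3) :=
    fun X hX hr => nullity_cap_core M hfree 3 (by omega) X hX
      (by rwa [show (6 - 1 - 1 - 1 : ℕ) = 3 by omega] at hr)
  have hUG : (Matroid.UG M 6 7).ncard ≤ 13 := by
    have := Matroid.ncard_UG_le_cf (M := M) (q := 6) (ν₁ := 7) (j := 2) (by norm_num) hcf hR' hn (by omega) hc hc6 hcj (by norm_num [cnull])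
    simpa using this
  have hUH : (Matroid.UH M 6 7).ncard ≤ 12 := by
    have := Matroid.ncard_UH_le_cf (M := M) (q := 6) (ν₁ := 7) (j' := 1) (by norm_num) hcf hR' hn (by omega) hc hc6 hcj' (by norm_num [cnull])
    simpa using this
  have hΦ : phiK 22 6 ≤ (2 : ℚ) ^ (22 + 6) / (((22 + 6).choose 6 : ℕ) : ℚ) := phiK_le_two_pow_div_six 22
  rw [RLS_iff]
  exact c025_core_six_heavy_cell_sq27di2v M 22 8 7 13 12 0 10000 200 14 432 62 2 1155 2238
      ((22 + 6).choose 6) (Nat.choose_pos (by omega)) (phiK 22 6) hΦ (by norm_num) (by omega)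
      (by norm_num) hUG hUH (by omega) (Or.inl (by norm_num)) (by norm_num) (by norm_num) (by norm_num)
      hs3
      ((S1.ncard_fourCircuits_le_gb14 8 M hfree hd 30 (by rw [coloops_eq_empty_of_forall M hcf, Set.sdiff_empty, hn])).trans (by decide))
      (s5_cf_of M hfree hcf (d := 7) (by rw [hd]; norm_num) 30 360 432 (by norm_num) (by omega) (by decide) (by omega))
      (s6_cf_of M hfree hcf (d := 7) (by rw [hd]; norm_num) 30 924 1155 (by norm_num) (by omega) (by decide) (by omega))
      (s7_cf_of M hfree hcf (d := 7) (by rw [hd]; norm_num) 30 1716 2238 (by norm_num) (by omega) (by decide) (by omega))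
      (Or.inl tail_six_two_sq22F8) hR' hn hfree level_six_poly_two_sq22F8

set_option maxHeartbeats 1600000 in
/-- **THE COLOOP-FREE CELL `(22, 8)` WITH THREE DISTINCT TRIANGLES AND AT MOST SIX** (THE THREE-TRIANGLE CELL, `c₃ = 6`). -/
theorem c025_core_six_t22_free8_tritri (M : Matroid α) [M.Finite] (hcf : ∀ e ∈ M.E, ¬ M.IsColoop e)
    (hR : M.eRank = (22 : ℕ∞)) (hn : M.E.ncard = 22 + 8)
    (hfree : ∀ e ∈ M.E, ∃ A ⊆ M.E \ {e}, e ∉ M.closure A ∧ e ∉ M.closure ((M.E \ {e}) \ A))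
    (hs3 : {C : Set α | M.IsCircuit C ∧ C.ncard = 3}.ncard ≤ 6)
    (hthree : ∃ C₁ C₂ C₃ : Set α, M.IsCircuit C₁ ∧ M.IsCircuit C₂ ∧ M.IsCircuit C₃ ∧ C₁.ncard = 3 ∧ C₂.ncard = 3 ∧
      C₃.ncard = 3 ∧ C₁ ≠ C₂ ∧ C₁ ≠ C₃ ∧ C₂ ≠ C₃) :
    RLS M 22 6 := by
  classical
  have hR' : M.eRank = ((22 : ℕ) : ℕ∞) := hR
  have hd : M.E.encard = M.eRank + (8 : ℕ) := by
    rw [hR, ← M.ground_finite.cast_ncard_eq, hn]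
    push_cast
    ring
  have hc : ∀ X ⊆ M.E, M.eRk X ≤ ((6 - 2 : ℕ) : ℕ∞) → (X.ncard : ℕ∞) ≤ M.eRk X + cnull 4 :=
    fun X hX hr => nullity_cap_core M hfree 4 (le_refl 4) X hX (by simpa using hr)
  have hc6 : cnull 4 + 1 ≤ 7 := by simp [cnull]
  have hcj : ∀ X ⊆ M.E, M.eRk X ≤ ((6 - 2 - 1 : ℕ) : ℕ∞) → (X.ncard : ℕ∞) ≤ M.eRk X + cnull (3) :=
    fun X hX hr => nullity_cap_core M hfree 3 (by omega) X hX
      (by rwa [show (6 - 2 - 1 : ℕ) = 3 by omega] at hr)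
  have hcj' : ∀ X ⊆ M.E, M.eRk X ≤ ((6 - 1 - 1 - 1 : ℕ) : ℕ∞) → (X.ncard : ℕ∞) ≤ M.eRk X + cnull (3) :=
    fun X hX hr => nullity_cap_core M hfree 3 (by omega) X hX
      (by rwa [show (6 - 1 - 1 - 1 : ℕ) = 3 by omega] at hr)
  have hUG : (Matroid.UG M 6 7).ncard ≤ 13 := by
    have := Matroid.ncard_UG_le_cf (M := M) (q := 6) (ν₁ := 7) (j := 2) (by norm_num) hcf hR' hn (by omega) hc hc6 hcj (by norm_num [cnull])
    simpa using this
  have hUH : (Matroid.UH M 6 7).ncard ≤ 12 := by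
    have := Matroid.ncard_UH_le_cf (M := M) (q := 6) (ν₁ := 7) (j' := 1) (by norm_num) hcf hR' hn (by omega) hc hc6 hcj' (by norm_num [cnull])
    simpa using this
  have hΦ : phiK 22 6 ≤ (2 : ℚ) ^ (22 + 6) / (((22 + 6).choose 6 : ℕ) : ℚ) := phiK_le_two_pow_div_six 22
  rw [RLS_iff]
  exact c025_core_six_heavy_cell_sq27di2v_tritri M 22 8 7 13 12 0 10000 200 14 432 62 6 1155 2238
      ((22 + 6).choose 6) (Nat.choose_pos (by omega)) (phiK 22 6) hΦ (by norm_num) (by omega)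
      (by norm_num) hUG hUH (by omega) (Or.inl (by norm_num)) (by norm_num) (by norm_num) (by norm_num)
      hs3
      ((S1.ncard_fourCircuits_le_gb14 8 M hfree hd 30 (by rw [coloops_eq_empty_of_forall M hcf, Set.sdiff_empty, hn])).trans (by decide))
      (s5_cf_of M hfree hcf (d := 7) (by rw [hd]; norm_num) 30 360 432 (by norm_num) (by omega) (by decide) (by omega))
      (s6_cf_of M hfree hcf (d := 7) (by rw [hd]; norm_num) 30 924 1155 (by norm_num) (by omega) (by decide) (by omega))
      (s7_cf_of M hfree hcf (d := 7) (by rw [hd]; norm_num) 30 1716 2238 (by norm_num) (by omega) (by decide) (by omega))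
      (Or.inl tail_six_tritri_sq22F8) hR' hn hfree (by omega) hthree level_six_poly_tritri_sq22F8

/-- **THE COLOOP-FREE CELL `(22, 8)` MODULO THE BRANCH `s₃ ≥ 7`**: at most two triangles, or three to six, or the hypothesis. -/
theorem c025_core_six_t22_free8_of_seven (M : Matroid α) [M.Finite] (hcf : ∀ e ∈ M.E, ¬ M.IsColoop e)
    (hR : M.eRank = (22 : ℕ∞)) (hn : M.E.ncard = 22 + 8)
    (hfree : ∀ e ∈ M.E, ∃ A ⊆ M.E \ {e}, e ∉ M.closure A ∧ e ∉ M.closure ((M.E \ {e}) \ A))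
    (h7 : 7 ≤ {C : Set α | M.IsCircuit C ∧ C.ncard = 3}.ncard → RLS M 22 6) :
    RLS M 22 6 := by
  classical
  have hfin : {C : Set α | M.IsCircuit C ∧ C.ncard = 3}.Finite :=
    M.ground_finite.finite_subsets.subset (fun C hC => hC.1.subset_ground)
  by_cases hbig : 7 ≤ {C : Set α | M.IsCircuit C ∧ C.ncard = 3}.ncard
  · exact h7 hbig
  by_cases h : 2 < {C : Set α | M.IsCircuit C ∧ C.ncard = 3}.ncard
  · obtain ⟨C₁, C₂, C₃, hC₁, hC₂, hC₃, h12, h13, h23⟩ := (Set.two_lt_ncard_iff hfin).1 h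
    exact c025_core_six_t22_free8_tritri M hcf hR hn hfree (by omega)
      ⟨C₁, C₂, C₃, hC₁.1, hC₂.1, hC₃.1, hC₁.2, hC₂.2, hC₃.2, h12, h13, h23⟩
  · exact c025_core_six_t22_free8_two M hcf hR hn hfree (by omega)

end ThmN

end PercRepro
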